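import Summits.NavierStokesRegularity.NavierStokesRegularity.Theses.SubcubicESS

/-!
# NavierStokesRegularity — route `SubcubicESS`, assembly

Settles `stmt-NavierStokesRegularity-10677` (assembly of route SubcubicESS):

  `SubcubicBound → EnergyBridge → UniformESSClosure → NoBlowupToClay → NavierStokesRegularity`.

The hypotheses are, up to order, the hypotheses of the route's deciding theorem
`Summit.NavierStokesRegularity.NavierStokesRegularity.Theses.SubcubicESS.closes`, so the assembly
is that theorem with its arguments permuted. For the record, the logic of `closes` (pure logic, no
analysis): from `SubcubicBound` take the size function `F` with its velocity clause;
`UniformESSClosure ⟨F, ·⟩` is the `L³` continuation criterion for classical Leray–Hopf solutions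
from rapidly decaying data; `EnergyBridge` turns `SubcubicBound` into the uniform bound
`⨆_{t<T} ‖u(t)‖₃ < ⊤` for every such solution; together they give `HasSmoothExtensionPast ν 0 u T`
for all `ν, T > 0`, which is exactly the premise of `NoBlowupToClay`. Nothing here is new
mathematics; the open content lives in the crux `SubcubicBound`.
-/

-- the summit and its single sub-problem share the name (CONVENTIONS §1), as in every Theorems file
set_option linter.dupNamespace false

namespace Summit.NavierStokesRegularity.NavierStokesRegularity.Theorems

open Summit.NavierStokesRegularity.NavierStokesRegularity.Theses

/-- Assembly of route SubcubicESS (`stmt-NavierStokesRegularity-10677`):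
`SubcubicBound → EnergyBridge → UniformESSClosure → NoBlowupToClay → NavierStokesRegularity`,
obtained from the route's deciding theorem `SubcubicESS.closes` by permuting its hypotheses
(from `SubcubicBound` take `F`; `UniformESSClosure ⟨F, velocity clause⟩` is the `L³` criterion;
`EnergyBridge` bounds `⨆_{t<T} ‖u(t)‖₃`; hence `HasSmoothExtensionPast` for all `ν, T > 0`, the
premise of `NoBlowupToClay`). [folklore] -/
theorem subcubicESS_assembly_proof : SubcubicESS.Assembly := by
  unfold SubcubicESS.Assembly
  intro hX hBridge hESS hClay
  exact SubcubicESS.closes hX hClay hBridge hESS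

end Summit.NavierStokesRegularity.NavierStokesRegularity.Theorems
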